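import Literature.NumberTheory.NumberFields.RayClassFieldFrobeniusOrderGrowth
import HarnessLib

/-!
# THE ORDER OF THE FROBENIUS OF `v` ON `K(𝔤v'^n)`, FULL FORM: `f·p^{n−m+1} ∣ ord Frob_v(K(𝔤v'^n))` when `(α) = 𝔭_v^f` with `f` dividing
# `ord Frob_v(K(𝔤))` — `f` NOT assumed prime to `p` (the 2-power part of the residue degree of `v` in `K(𝔤)` is kept)

`RayClassFieldFrobeniusOrderGrowth` (g16 S39) proves `d·p^{n−m+1} ∣ ord Frob_v(K(𝔤v'^n)/K)` for a PRIME-TO-`p` divisor `d` of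
`ord Frob_v(K(𝔤)/K)` (coprime `lcm`), from one `α ≡ 1 mod 𝔤`, `(α) = 𝔭_v^f`, of `v'`-level `ℓ` with `α^p` of exact level `m`.  When the residue
degree `o` of `v` in `K(𝔤)` has a `p`-part `p^b` (for the conductor `𝔤 ⊇ 𝔣_θ` of a quadratic character this is the rule, not the exception),
the coprime `lcm` loses `p^b`.  The true order is a PRODUCT: `Frob^t = 1` on `K(𝔤v'^n)` forces `o ∣ t` (restriction to `K(𝔤)`), `t = f·j` when
`f ∣ o`, and THEN `Frob^{f·j} = ((α^j), K(𝔤v'^n)/K) = 1` forces `p^{n−m+1} ∣ j` (lifting the exponent).  THIS file proves (0 sorry, no definitions):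

* ★ `pow_prime_succ_dvd_of_artinHom_pow_eq_one` — `((α^j), K(𝔤v'^n)/K) = 1`, `n ≥ m` ⟹ `p^{n−m+1} ∣ j` (the second half of
  `pow_prime_dvd_of_galFrob_pow_eq_one_of_pow_level`, isolated);
* ★★ **`mul_pow_prime_succ_dvd_orderOf_galFrob_of_dvd_orderOf`** — `f ∣ ord Frob_v(K(𝔤))` ⟹ **`f·p^{n−m+1} ∣ ord Frob_v(K(𝔤v'^n))`**, `f` arbitrary;
  ★★ `mul_pow_prime_succ_dvd_orderOf_frob_idelic_of_dvd_orderOf` — the idelic form consumed by the INERT criterion.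

With `f = d₀·p^b` (`d₀` prime to `p`) this feeds the (c)-capstone tower with the 2-power OFFSET `c = b + 1` (`RayClassFieldTwoVariableTowerDataOffset`).
Cell `bsd-print-cf2`, width seat `bsd-line-cf2c-w7` g17.

## References
* [deShalit1987] E. de Shalit, *Iwasawa theory of elliptic curves with complex multiplication* (1987), II.1.9 (p. 43), II.1.10 (p. 39),
  II.4.14 (p. 71), II.4.17 (p. 78).
* [Serre1973CourseArithmetic] J.-P. Serre, *A Course in Arithmetic* (1973), Ch. II §3.1.
* [NeukirchANT1999] J. Neukirch, *Algebraic Number Theory* (1999), Ch. VI §7 Thm. (7.1), Cor. (7.3).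
-/

noncomputable section

open NumberField IsDedekindDomain IsDedekindDomain.HeightOneSpectrum Field WithZero
open scoped nonZeroDivisors Classical

namespace Literature.NumberTheory.NumberFields

open Literature.NumberTheory.GaloisRepresentations
open Literature.NumberTheory.GaloisRepresentations.ArtinLocalGlobal
open Literature.NumberTheory.LFunctions.AbelianDensity (artinSymbol artinSymbol_mul artinSymbol_asIdeal)
open Literature.RingTheory.DedekindDomain
open ValuativeRel

variable {K : Type} [Field K] [NumberField K] {𝔤 : Ideal (𝓞 K)} {v v' : HeightOneSpectrum (𝓞 K)}

/-- `¬ 𝔤v'^n ≤ v` for `v ∤ 𝔤`, `v ≠ v'`. [cite: deShalit1987, II.4.14 (p. 71)] -/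
private theorem not_mul_pow_le₂₁ (hv : ¬ 𝔤 ≤ v.asIdeal) (hvv' : v' ≠ v) (n : ℕ) : ¬ 𝔤 * v'.asIdeal ^ n ≤ v.asIdeal := by
  intro h
  rcases (v.isPrime.mul_le).mp h with h1 | h2
  · exact hv h1
  · rcases n with _ | n
    · rw [pow_zero, Ideal.one_eq_top, top_le_iff] at h2
      exact v.isPrime.ne_top h2
    · exact hvv' (HeightOneSpectrum.ext ((v'.isMaximal.eq_of_le v.isPrime.ne_top ((Ideal.IsPrime.pow_le_iff (hP := v.isPrime)
        (Nat.succ_ne_zero n)).mp h2))))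

variable [IsTotallyComplex K]
  (h𝔤0 : 𝔤 ≠ ⊥) (hv : ¬ 𝔤 ≤ v.asIdeal) (hv' : ¬ 𝔤 ≤ v'.asIdeal) (hvv' : v' ≠ v)
  (hw𝔤 : ∀ u : (𝓞 K)ˣ, (u : 𝓞 K) - 1 ∈ 𝔤 → u = 1)
  {p : ℕ} (hp : p.Prime) (hpv' : (p : 𝓞 K) ∈ v'.asIdeal) (hpv'2 : (p : 𝓞 K) ∉ v'.asIdeal ^ 2)
  {α : 𝓞 K} (hα0 : α ≠ 0) (hα𝔤 : α - 1 ∈ 𝔤) {f : ℕ} (hαf : Ideal.span {α} = v.asIdeal ^ f)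

include h𝔤0 hv' hw𝔤 hp hpv' hpv'2 hα𝔤 in
/-- ★ **`((α^j), K(𝔤v'^n)/K) = 1`, `n ≥ m` ⟹ `p^{n−m+1} ∣ j`** for `α ≡ 1 mod 𝔤` of `v'`-level `ℓ ≥ 1` whose `p`-th power has exact level `m`
(`m ≥ 2` or `p ≠ 2`): `α^j ≡ 1 mod v'^n` (`w_𝔤 = 1`), exponents prime to `p` keep the level `ℓ < n`, so `p ∣ j`, and lifting the exponent from
`α^p` gives `p^{n−m} ∣ j/p`. [cite: deShalit1987, II.1.9 (p. 43), II.4.17 (p. 78)] [cite: Serre1973CourseArithmetic, Ch. II §3.1] -/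
theorem pow_prime_succ_dvd_of_artinHom_pow_eq_one {ℓ m : ℕ} (hℓ : 1 ≤ ℓ) (hαℓ : v'.intValuation (α - 1) = exp (-(ℓ : ℤ)))
    (hm2 : 2 ≤ m ∨ p ≠ 2) (hαm : v'.intValuation (α ^ p - 1) = exp (-(m : ℤ))) {n : ℕ} (hn : m ≤ n) {j : ℕ}
    (h1 : artinHom (galFrob K (rayClassField K (𝔤 * v'.asIdeal ^ n)))
        (toPrincipalIdeal (𝓞 K) K (Units.mk0 ((α ^ j : 𝓞 K) : K) (by exact_mod_cast pow_ne_zero j hα0))) = 1) :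
    p ^ (n - m + 1) ∣ j := by
  haveI := Fact.mk hp
  rcases eq_or_ne j 0 with rfl | hj0
  · exact dvd_zero _
  have hαv' : α ∉ v'.asIdeal := by
    intro h
    have h1 : v'.intValuation (α - 1) < 1 := by rw [hαℓ, ← exp_zero, exp_lt_exp]; omega
    rw [intValuation_lt_one_iff_mem] at h1
    exact v'.isPrime.ne_top ((Ideal.eq_top_iff_one _).mpr (by simpa using v'.asIdeal.sub_mem h h1))
  -- `m ≥ ℓ + 1`
  have hmℓ : ℓ + 1 ≤ m := by
    have hx1 : α - 1 ∈ v'.asIdeal := by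
      rw [← intValuation_lt_one_iff_mem, hαℓ, ← exp_zero, exp_lt_exp]; omega
    have hS : (∑ i ∈ Finset.range p, α ^ i) ∈ v'.asIdeal := by
      have e : (∑ i ∈ Finset.range p, α ^ i) = (∑ i ∈ Finset.range p, (α ^ i - 1)) + (p : 𝓞 K) := by
        rw [Finset.sum_sub_distrib, Finset.sum_const, Finset.card_range, nsmul_eq_mul, mul_one, sub_add_cancel]
      rw [e]
      refine v'.asIdeal.add_mem (Ideal.sum_mem _ fun i _ ↦ ?_) hpv'
      rw [← geom_sum_mul α i]
      exact Ideal.mul_mem_left _ _ hx1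
    have hval : v'.intValuation (α ^ p - 1) ≤ exp (-((ℓ + 1 : ℕ) : ℤ)) := by
      have hS' : v'.intValuation (∑ i ∈ Finset.range p, α ^ i) ≤ exp (-((1 : ℕ) : ℤ)) :=
        (v'.intValuation_le_pow_iff_mem _ 1).mpr (by rwa [pow_one])
      rw [← geom_sum_mul α p, map_mul, hαℓ]
      calc v'.intValuation (∑ i ∈ Finset.range p, α ^ i) * exp (-(ℓ : ℤ)) ≤ exp (-((1 : ℕ) : ℤ)) * exp (-(ℓ : ℤ)) := by
            gcongr
        _ = exp (-((ℓ + 1 : ℕ) : ℤ)) := by rw [← exp_add]; congr 1; push_cast; ring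
    rw [hαm, exp_le_exp] at hval
    omega
  have hm : 1 ≤ m := by omega
  have hαj𝔤 : α ^ j - 1 ∈ 𝔤 := by
    rw [← geom_sum_mul α j]
    exact Ideal.mul_mem_left _ _ hα𝔤
  have hαjv' : α ^ j ∉ v'.asIdeal := fun h ↦ hαv' (v'.isPrime.mem_of_pow_mem j h)
  have h2 := (artinHom_toPrincipalIdeal_rayClassField_mul_pow_eq_one_iff h𝔤0 hv' hw𝔤 (pow_ne_zero j hα0) hαj𝔤 hαjv' n).mp h1
  -- `p ∣ j`: otherwise `α^j` has level `ℓ < n`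
  have hpj : p ∣ j := by
    by_contra hpj
    have hlev := intValuation_pow_sub_one_of_not_dvd v' hp hpv' hℓ hαℓ hpj
    rw [← intValuation_le_pow_iff_mem, hlev, exp_le_exp] at h2
    omega
  obtain ⟨j', rfl⟩ := hpj
  have hj'0 : j' ≠ 0 := by rintro rfl; exact hj0 (mul_zero p)
  rw [pow_mul, ← Nat.add_sub_cancel' hn] at h2
  have h3 := (pow_sub_one_mem_pow_iff v' hp hpv' hpv'2 hm hm2 hαm hj'0 (n - m)).mp h2
  rw [pow_succ, mul_comm]
  exact mul_dvd_mul_left p h3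

include h𝔤0 hv hv' hvv' hw𝔤 hp hpv' hpv'2 hα0 hα𝔤 hαf in
/-- ★★ **FULL FORM: `f·p^{n−m+1} ∣ ord Frob_v(K(𝔤v'^n)/K)`** for `n ≥ m`, whenever `(α) = 𝔭_v^f` with `f ∣ ord Frob_v(K(𝔤)/K)` (so `f` IS that
residue degree, `2`-power part included), `α ≡ 1 mod 𝔤` of level `ℓ ≥ 1` with `α^p` of exact level `m`: the order `t` on `K(𝔤v'^n)` is a multiple
of `f` (restriction to `K(𝔤)`), `t = f·j`, and `Frob^{f·j} = ((α^j), ·) = 1` gives `p^{n−m+1} ∣ j`. [cite: deShalit1987, II.1.9 (p. 43), II.4.14 (p. 71)]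
[cite: NeukirchANT1999, Ch. VI §7 Cor. (7.3)] [cite: Serre1973CourseArithmetic, Ch. II §3.1] -/
theorem mul_pow_prime_succ_dvd_orderOf_galFrob_of_dvd_orderOf {ℓ m : ℕ} (hℓ : 1 ≤ ℓ) (hαℓ : v'.intValuation (α - 1) = exp (-(ℓ : ℤ)))
    (hm2 : 2 ≤ m ∨ p ≠ 2) (hαm : v'.intValuation (α ^ p - 1) = exp (-(m : ℤ)))
    (hfo : f ∣ orderOf (galFrob K (rayClassField K 𝔤) v)) {n : ℕ} (hn : m ≤ n) :
    f * p ^ (n - m + 1) ∣ orderOf (galFrob K (rayClassField K (𝔤 * v'.asIdeal ^ n)) v) := by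
  have hft : f ∣ orderOf (galFrob K (rayClassField K (𝔤 * v'.asIdeal ^ n)) v) :=
    hfo.trans (orderOf_galFrob_dvd_of_le h𝔤0 (mul_ne_zero h𝔤0 (pow_ne_zero _ v'.ne_bot)) hv (not_mul_pow_le₂₁ hv hvv' n)
      (rayClassField_le_of_le (mul_ne_zero h𝔤0 (pow_ne_zero _ v'.ne_bot)) Ideal.mul_le_right))
  obtain ⟨j, hj⟩ := hft
  have h1 : artinHom (galFrob K (rayClassField K (𝔤 * v'.asIdeal ^ n)))
      (toPrincipalIdeal (𝓞 K) K (Units.mk0 ((α ^ j : 𝓞 K) : K) (by exact_mod_cast pow_ne_zero j hα0))) = 1 := by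
    rw [← galFrob_pow_mul_eq_artinHom_pow hα0 hαf, ← hj]
    exact pow_orderOf_eq_one _
  rw [hj]
  exact mul_dvd_mul_left f (pow_prime_succ_dvd_of_artinHom_pow_eq_one h𝔤0 hv' hw𝔤 hp hpv' hpv'2 hα0 hα𝔤 hℓ hαℓ hm2 hαm hn h1)

include h𝔤0 hv hv' hvv' hw𝔤 hp hpv' hpv'2 hα0 hα𝔤 hαf in
/-- ★★ **Full idelic form** (input of the INERT criterion with `[E':K_v] = f·p^{n−m+1}`, `f` of any parity): for a uniformiser `π` of `K_v`,
`f·p^{n−m+1} ∣ ord [⟨π⟩_v, K]|_{K(𝔤v'^n)}`. [cite: deShalit1987, II.1.10 (p. 39), II.4.14 (p. 71)] [cite: NeukirchANT1999, Ch. VI §7 Thm. (7.1)] -/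
theorem mul_pow_prime_succ_dvd_orderOf_frob_idelic_of_dvd_orderOf {ℓ m : ℕ} (hℓ : 1 ≤ ℓ)
    (hαℓ : v'.intValuation (α - 1) = exp (-(ℓ : ℤ))) (hm2 : 2 ≤ m ∨ p ≠ 2) (hαm : v'.intValuation (α ^ p - 1) = exp (-(m : ℤ)))
    (hfo : f ∣ orderOf (galFrob K (rayClassField K 𝔤) v)) {n : ℕ} (hn : m ≤ n)
    {π : 𝒪[v.adicCompletion K]} (hπ : (valuation (v.adicCompletion K)).IsUniformizer (π : v.adicCompletion K)) :
    ((f * p ^ (n - m + 1) : ℕ) : ℤ) ∣ (orderOf (abRestrict (rayClassField K (𝔤 * v'.asIdeal ^ n))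
      (ideleArtinMap K (localUnits v (Units.mk0 (π : v.adicCompletion K) hπ.ne_zero)))) : ℤ) := by
  rw [abRestrict_ideleArtinMap_rayClassField_localUnits (mul_ne_zero h𝔤0 (pow_ne_zero _ v'.ne_bot)) (not_mul_pow_le₂₁ hv hvv' n)
    (valued_eq_exp_neg_one_of_isUniformizer (hx := hπ))]
  exact_mod_cast mul_pow_prime_succ_dvd_orderOf_galFrob_of_dvd_orderOf h𝔤0 hv hv' hvv' hw𝔤 hp hpv' hpv'2 hα0 hα𝔤 hαf hℓ hαℓ hm2 hαm
    hfo hn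

end Literature.NumberTheory.NumberFields

end
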